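import Summits.RiemannHypothesis.RiemannHypothesis.Theorems.GroundBartaPolarPerronFrobeniusThinLayerCoerciveNumerics
import HarnessLib

/-!
# RiemannHypothesis / GroundBarta — crux `PolarPerronFrobenius` (stmt-RiemannHypothesis-18390):
# thin-layer log-coercivity of Weil's Markov form, part 3: the EDGE-LAYER ENGINE

Helper file (`--supports stmt-RiemannHypothesis-18390`), RH-free, Mathlib + proved tree files only,
no definitions, no named facts.  Parts 1–2 (`…ThinLayerCoercive.lean`, `…ThinLayerCoerciveNumerics.lean`)
gave the two-layer bound with the resonant band removed and the constants
`2∫_ζ^∞ w ≥ log(1/ζ) + 19/10`, `c_A ≤ 33/5`.  Here: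

* `tl_band_card_le_one`: for `a ≥ 5`, `0 < ζ ≤ e^{-2a}/4` the resonant band `[2a − 2ζ, 2a)` of the two
  edge layers contains AT MOST ONE prime power (`e^{2a}(1 − e^{-2ζ}) ≤ 1/2 < 1`);
* `tl_band_sum_le`: its rate is `≤ 2a e^{-a}(1 + 2ζ) ≤ 1/14`; `tl_archBand_le`: `∫_{band} w ≤ 2ζ`;
* `tl_edgeLayers_coercive`: **the engine** — for every window `a ≥ 5`, width `0 < ζ ≤ e^{-2a}/4` and
  test `g` supported in `[-a, -a+ζ] ∪ [a−ζ, a]`,  `a · ‖g‖₂² ≤ Q₀(g) = Re Q(g) − P(g)`.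
  This is the statement `EdgeLayerCoercive a ζ a` of the harmonic-majorant card
  (`Cruxes/PolarPerronFrobenius/Ideas/harmonic-majorant-edge-source.md`, engine
  `edgeLayerCoercive_eventually`, asked there with `κ = a/2` at width `e^{-a}/(8a)`), def-free, for
  every width up to `e^{-2a}/4 ≥ ℓ_a = e^{-2a}/(2π)` — the tail width at which the card computes its
  edge source; a thinner support only helps (`tsupport`-monotone hypothesis).

Prover B, speedrun unit `sr-gb-rung-b` (seat 2).
-/

set_option linter.dupNamespace false

noncomputable section

open Set MeasureTheory Filter Complex
open scoped Real Topology

namespace Summit.RiemannHypothesis.RiemannHypothesis.Theorems.PolarPerronFrobenius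

open Literature.NumberTheory.LFunctions
open scoped ArithmeticFunction.vonMangoldt

/-! ## Two edge layers: the engine `EdgeLayerCoercive a ζ a` for `a ≥ 5`, `ζ ≤ e^{-2a}/4` -/

section EdgeLayers

variable {g : ℝ → ℂ} {a ζ : ℝ}

/-- `e^5 ≥ 148`. [folklore] -/
theorem tl_exp_five_ge : (148 : ℝ) ≤ Real.exp 5 := by
  have h := Real.exp_one_gt_d9
  have h5 : Real.exp 5 = Real.exp 1 ^ 5 := by
    rw [← Real.exp_nat_mul]; norm_num
  rw [h5]
  have : (148 : ℝ) ≤ (2.7182818283 : ℝ) ^ 5 := by norm_num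
  exact this.trans (pow_le_pow_left₀ (by norm_num) h.le 5)

/-- `4a e^{-a} ≤ 5/37` for `a ≥ 5` (`e^a ≥ e^5 (1 + (a − 5))`, `4a ≤ 4 (1 + (a − 5)) · 5`). [folklore] -/
theorem tl_four_mul_exp_neg_le (ha : 5 ≤ a) : 4 * a * Real.exp (-a) ≤ 5 / 37 := by
  have h1 : Real.exp 5 * (1 + (a - 5)) ≤ Real.exp a := by
    have h := Real.add_one_le_exp (a - 5)
    have h' : Real.exp a = Real.exp 5 * Real.exp (a - 5) := by
      rw [← Real.exp_add]; congr 1; ring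
    rw [h']
    exact mul_le_mul_of_nonneg_left (by linarith) (Real.exp_pos 5).le
  have h2 := tl_exp_five_ge
  have hea : 0 < Real.exp a := Real.exp_pos a
  rw [Real.exp_neg, ← div_eq_mul_inv, div_le_iff₀ hea]
  nlinarith

/-- `e^{2a} ≥ 1024` for `a ≥ 5`. [folklore] -/
theorem tl_exp_two_mul_ge (ha : 5 ≤ a) : (1024 : ℝ) ≤ Real.exp (2 * a) := by
  have h1 : Real.exp 10 ≤ Real.exp (2 * a) := Real.exp_le_exp.2 (by linarith)
  have h2 : (1024 : ℝ) ≤ Real.exp 10 := by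
    have h := Real.exp_one_gt_d9
    have h10 : Real.exp 10 = Real.exp 1 ^ 10 := by
      rw [← Real.exp_nat_mul]; norm_num
    rw [h10]
    have : (1024 : ℝ) ≤ (2.7182818283 : ℝ) ^ 10 := by norm_num
    exact this.trans (pow_le_pow_left₀ (by norm_num) h.le 10)
  linarith

/-- For `a ≥ 5` and `ζ ≤ e^{-2a}/4`: `ζ ≤ 1/4096`. [folklore] -/
theorem tl_width_le (ha : 5 ≤ a) (hζa : ζ ≤ Real.exp (-(2 * a)) / 4) : ζ ≤ 1 / 4096 := by
  have h := tl_exp_two_mul_ge ha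
  have hE : 0 < Real.exp (2 * a) := Real.exp_pos _
  have h1 : Real.exp (-(2 * a)) ≤ 1 / 1024 := by
    rw [Real.exp_neg, ← one_div]
    exact one_div_le_one_div_of_le (by norm_num) h
  linarith

/-- **At most one prime power in the resonant band.**  For `0 < ζ ≤ e^{-2a}/4` the prime powers
`n` of the window (`log n < 2a`) with `|log n − (2a − ζ)| ≤ ζ` lie in `[e^{2a−2ζ}, e^{2a})`, an
interval of length `e^{2a}(1 − e^{-2ζ}) ≤ 2ζ e^{2a} ≤ 1/2`; so there is at most one. [folklore] -/
theorem tl_band_card_le_one (ha : 5 ≤ a) (hζ : 0 < ζ) (hζa : ζ ≤ Real.exp (-(2 * a)) / 4) :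
    ((weilPrimeIndex a).filter (fun n : ℕ ↦ |Real.log (n : ℝ) - (2 * a - ζ)| ≤ ζ)).card ≤ 1 := by
  have hζ1 := tl_width_le ha hζa
  -- every member is a real number in `[e^{2a-2ζ}, e^{2a})`
  have hmem : ∀ n ∈ (weilPrimeIndex a).filter (fun n : ℕ ↦ |Real.log (n : ℝ) - (2 * a - ζ)| ≤ ζ),
      Real.exp (2 * a - 2 * ζ) ≤ (n : ℝ) ∧ (n : ℝ) < Real.exp (2 * a) := by
    intro n hn
    obtain ⟨hI, hband⟩ := Finset.mem_filter.1 hn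
    have hlog : Real.log n < 2 * a := mem_weilPrimeIndex.1 hI
    have hb := (abs_le.1 hband).1
    have hlow : 2 * a - 2 * ζ ≤ Real.log n := by linarith
    have hpos : 0 < 2 * a - 2 * ζ := by linarith
    have hn0 : (0 : ℝ) < n := by
      rcases Nat.eq_zero_or_pos n with h0 | h0
      · subst h0
        simp only [Nat.cast_zero, Real.log_zero] at hlow
        linarith
      · exact_mod_cast h0
    constructor
    · calc Real.exp (2 * a - 2 * ζ) ≤ Real.exp (Real.log n) := Real.exp_le_exp.2 hlow
        _ = n := Real.exp_log hn0
    · calc (n : ℝ) = Real.exp (Real.log n) := (Real.exp_log hn0).symm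
        _ < Real.exp (2 * a) := Real.exp_lt_exp.2 hlog
  -- the interval has length `< 1`
  have hlen : Real.exp (2 * a) - Real.exp (2 * a - 2 * ζ) < 1 := by
    have h1 : 1 - 2 * ζ ≤ Real.exp (-(2 * ζ)) := by linarith [Real.add_one_le_exp (-(2 * ζ))]
    have h2 : Real.exp (2 * a - 2 * ζ) = Real.exp (2 * a) * Real.exp (-(2 * ζ)) := by
      rw [show 2 * a - 2 * ζ = 2 * a + -(2 * ζ) by ring, Real.exp_add]
    have h3 : Real.exp (2 * a) * Real.exp (-(2 * a)) = 1 := by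
      rw [← Real.exp_add]; simp
    have hE : 0 < Real.exp (2 * a) := Real.exp_pos _
    have h4 : Real.exp (2 * a) * (2 * ζ) ≤ 1 / 2 := by
      calc Real.exp (2 * a) * (2 * ζ) ≤ Real.exp (2 * a) * (Real.exp (-(2 * a)) / 2) :=
            mul_le_mul_of_nonneg_left (by linarith) hE.le
        _ = 1 / 2 := by rw [mul_div_assoc', h3]
    nlinarith
  refine Finset.card_le_one.2 fun n hn m hm ↦ ?_
  obtain ⟨hn1, hn2⟩ := hmem n hn
  obtain ⟨hm1, hm2⟩ := hmem m hm
  by_contra hne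
  rcases lt_or_gt_of_ne hne with h | h
  · have h' : (n : ℝ) + 1 ≤ m := by exact_mod_cast h
    linarith
  · have h' : (m : ℝ) + 1 ≤ n := by exact_mod_cast h
    linarith

/-- **The resonant band carries almost no rate**: `Σ_{band} Λ(n) n^{-1/2} ≤ 2a e^{-a}(1 + 2ζ) ≤ 1/14`
for `a ≥ 5`, `0 < ζ ≤ e^{-2a}/4` (one term at most, `Λ(n) ≤ log n < 2a`,
`√n = e^{(log n)/2} ≥ e^{a − ζ}`, `e^{ζ} ≤ 1 + 2ζ`, `4a e^{-a} ≤ 5/37`). [folklore] -/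
theorem tl_band_sum_le (ha : 5 ≤ a) (hζ : 0 < ζ) (hζa : ζ ≤ Real.exp (-(2 * a)) / 4) :
    ∑ n ∈ (weilPrimeIndex a).filter (fun n : ℕ ↦ |Real.log (n : ℝ) - (2 * a - ζ)| ≤ ζ),
        (Λ n : ℝ) / Real.sqrt n ≤ 1 / 14 := by
  set B := (weilPrimeIndex a).filter (fun n : ℕ ↦ |Real.log (n : ℝ) - (2 * a - ζ)| ≤ ζ) with hB
  have hζ0 := tl_width_le ha hζa
  have hζ1 : ζ ≤ 1 := by linarith
  have h5 := tl_four_mul_exp_neg_le ha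
  -- the per-term bound `2a e^{-a} (1 + 2ζ) ≤ 1/14`
  have hM : 2 * a * Real.exp (-a) * (1 + 2 * ζ) ≤ 1 / 14 := by
    have hea : 0 ≤ 2 * a * Real.exp (-a) := by have := Real.exp_pos (-a); positivity
    nlinarith
  have hM0 : 0 ≤ 2 * a * Real.exp (-a) * (1 + 2 * ζ) := by
    have := Real.exp_pos (-a); positivity
  -- per-term bound
  have hterm : ∀ n ∈ B, (Λ n : ℝ) / Real.sqrt n ≤ 2 * a * Real.exp (-a) * (1 + 2 * ζ) := by
    intro n hn
    obtain ⟨hI, hband⟩ := Finset.mem_filter.1 hn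
    have hlog : Real.log n < 2 * a := mem_weilPrimeIndex.1 hI
    have hlow : 2 * a - 2 * ζ ≤ Real.log n := by linarith [(abs_le.1 hband).1]
    have hn0 : (0 : ℝ) < n := by
      rcases Nat.eq_zero_or_pos n with h0 | h0
      · subst h0
        simp only [Nat.cast_zero, Real.log_zero] at hlow
        linarith
      · exact_mod_cast h0
    have hsqrt : Real.sqrt n = Real.exp (Real.log n / 2) := by
      rw [Real.exp_half, Real.exp_log hn0]
    have hΛ : (Λ n : ℝ) ≤ Real.log n := ArithmeticFunction.vonMangoldt_le_log
    have hΛ0 : (0 : ℝ) ≤ Λ n := ArithmeticFunction.vonMangoldt_nonneg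
    have hs0 : 0 < Real.sqrt n := Real.sqrt_pos.2 hn0
    -- `1/√n ≤ e^{-(a - ζ)} = e^{-a} e^{ζ} ≤ e^{-a} (1 + 2ζ)`
    have hinv : 1 / Real.sqrt n ≤ Real.exp (-a) * (1 + 2 * ζ) := by
      rw [hsqrt, one_div, ← Real.exp_neg]
      have h1 : Real.exp (-(Real.log n / 2)) ≤ Real.exp (-a + ζ) := Real.exp_le_exp.2 (by linarith)
      have h2 : Real.exp (-a + ζ) = Real.exp (-a) * Real.exp ζ := Real.exp_add _ _
      have h3 : Real.exp ζ ≤ 1 + 2 * ζ := by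
        have h := Real.abs_exp_sub_one_le (x := ζ) (by rw [abs_of_pos hζ]; exact hζ1)
        rw [abs_of_pos hζ] at h
        linarith [(abs_le.1 h).2]
      calc Real.exp (-(Real.log n / 2)) ≤ Real.exp (-a) * Real.exp ζ := h1.trans_eq h2
        _ ≤ Real.exp (-a) * (1 + 2 * ζ) := mul_le_mul_of_nonneg_left h3 (Real.exp_pos _).le
    calc (Λ n : ℝ) / Real.sqrt n = (Λ n : ℝ) * (1 / Real.sqrt n) := by ring
      _ ≤ (2 * a) * (Real.exp (-a) * (1 + 2 * ζ)) :=
          mul_le_mul (hΛ.trans hlog.le) hinv (by positivity) (by linarith)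
      _ = 2 * a * Real.exp (-a) * (1 + 2 * ζ) := by ring
  have hcard := tl_band_card_le_one ha hζ hζa
  calc ∑ n ∈ B, (Λ n : ℝ) / Real.sqrt n ≤ B.card • (2 * a * Real.exp (-a) * (1 + 2 * ζ)) :=
        Finset.sum_le_card_nsmul B _ _ hterm
    _ ≤ 1 • (2 * a * Real.exp (-a) * (1 + 2 * ζ)) := by
        rw [nsmul_eq_mul, nsmul_eq_mul]
        exact mul_le_mul_of_nonneg_right (by exact_mod_cast hcard) hM0
    _ = 2 * a * Real.exp (-a) * (1 + 2 * ζ) := one_nsmul _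
    _ ≤ 1 / 14 := hM

/-- **The archimedean band is negligible**: `∫_{[2a−2ζ, 2a]} w ≤ 2ζ` for `a ≥ 5`, `0 < ζ ≤ e^{-2a}/4`
(`w ≤ w(1) ≤ e^{1/2}/2 < 1` there, `w` non-increasing). [folklore] -/
theorem tl_archBand_le (ha : 5 ≤ a) (hζ : 0 < ζ) (hζa : ζ ≤ Real.exp (-(2 * a)) / 4) :
    ∫ t in Icc (2 * a - 2 * ζ) (2 * a), weilArchDensity t ≤ 2 * ζ := by
  have hζ1 := tl_width_le ha hζa
  have hlow : 1 ≤ 2 * a - 2 * ζ := by linarith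
  have hw1 : weilArchDensity 1 ≤ 1 := by
    have h := weilArchDensity_le_exp_half_div one_pos
    have h2 := tl_exp_half_lt
    rw [mul_one] at h
    linarith
  have hwi : IntegrableOn weilArchDensity (Icc (2 * a - 2 * ζ) (2 * a)) :=
    (integrableOn_weilArchDensity_Ioi (by norm_num : (0 : ℝ) < 1 / 2)).mono_set
      fun t ht ↦ lt_of_lt_of_le (by norm_num) (hlow.trans ht.1)
  have hle : ∫ t in Icc (2 * a - 2 * ζ) (2 * a), weilArchDensity t ≤
      ∫ t in Icc (2 * a - 2 * ζ) (2 * a), (1 : ℝ) := by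
    refine setIntegral_mono_on hwi (continuousOn_const.integrableOn_compact isCompact_Icc)
      measurableSet_Icc fun t ht ↦ ?_
    have ht1 : 1 ≤ t := hlow.trans ht.1
    exact (weilArchDensity_antitoneOn (mem_Ioi.2 one_pos) (mem_Ioi.2 (one_pos.trans_le ht1)) ht1).trans hw1
  rw [setIntegral_const, smul_eq_mul, mul_one, Real.volume_real_Icc_of_le (by linarith)] at hle
  linarith

/-- **The edge-layer engine (`EdgeLayerCoercive a ζ a`).**  For every window `a ≥ 5`, every width
`0 < ζ ≤ e^{-2a}/4` and every test `g` supported in the two edge layers `[-a, -a+ζ] ∪ [a−ζ, a]`,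

`a · ‖g‖₂² ≤ Q₀(g) = Re Q(g) − P(g)`.

This is the RH-free coercivity input of the harmonic-majorant line for `PolarPerronFrobenius`
(card `harmonic-majorant-edge-source`, engine `edgeLayerCoercive_eventually`, asked there with
`κ = a/2` at width `e^{-a}/(8a)`; here `κ = a` at every width `≤ e^{-2a}/4`, which covers the tail
width `ℓ_a = e^{-2a}/(2π)` at which the card's edge source is computed): on the edge layers the
Markov part dominates `ε(a)`-sized and `O(1)`-sized terms by a margin growing linearly in `a`.
[folklore] -/
theorem tl_edgeLayers_coercive (ha : 5 ≤ a) (hζ : 0 < ζ) (hζa : ζ ≤ Real.exp (-(2 * a)) / 4)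
    (hg : IsWeilTest g) (hS : tsupport g ⊆ Icc (-a) (-a + ζ) ∪ Icc (a - ζ) a) :
    a * ∫ x : ℝ, ‖g x‖ ^ 2 ≤ weilMarkovQuadratic g := by
  have hζ1 := tl_width_le ha hζa
  have hζ2 : ζ < Real.log 2 := by linarith [Real.log_two_gt_d9]
  have hS' : tsupport g ⊆ Icc (-a) (-a + ζ) ∪ Icc (a - ζ) (a - ζ + ζ) := by
    rwa [sub_add_cancel]
  have hwin : tsupport g ⊆ Icc (-a) a := by
    intro x hx
    rcases hS hx with h | h
    · exact ⟨h.1, by linarith [h.2]⟩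
    · exact ⟨by linarith [h.1], h.2⟩
  have hd : 2 * ζ ≤ a - ζ - -a := by linarith
  have h := tl_weilMarkovQuadratic_ge_of_twoLayers hg hζ hζ2 hd hS' hwin
  have hdd : a - ζ - -a = 2 * a - ζ := by ring
  rw [hdd, show 2 * a - ζ - ζ = 2 * a - 2 * ζ by ring, show 2 * a - ζ + ζ = 2 * a by ring] at h
  -- the archimedean gaps: `∫_{(ζ,∞) \ band} w = ∫_{(ζ,∞)} w − ∫_{band} w`
  have hwi : IntegrableOn weilArchDensity (Ioi ζ) := integrableOn_weilArchDensity_Ioi hζ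
  have hsub : Icc (2 * a - 2 * ζ) (2 * a) ⊆ Ioi ζ := fun t ht ↦ by
    have : ζ < 2 * a - 2 * ζ := by linarith
    exact lt_of_lt_of_le this ht.1
  have hdiff : ∫ t in Ioi ζ \ Icc (2 * a - 2 * ζ) (2 * a), weilArchDensity t =
      (∫ t in Ioi ζ, weilArchDensity t) - ∫ t in Icc (2 * a - 2 * ζ) (2 * a), weilArchDensity t :=
    setIntegral_sdiff measurableSet_Icc hwi hsub
  have h1 := tl_setIntegral_Ioi_weilArchDensity_ge hζ (by linarith)
  have h2 := tl_archKilling_le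
  have h3 := tl_band_sum_le ha hζ hζa
  have h4 := tl_archBand_le ha hζ hζa
  have h5 := tl_four_mul_exp_neg_le ha
  -- `log(1/ζ) ≥ 2a + log 4`
  have h6 : 2 * a + 2 * Real.log 2 ≤ Real.log (1 / ζ) := by
    have hE : 0 < Real.exp (-(2 * a)) := Real.exp_pos _
    have hq : 4 * Real.exp (2 * a) ≤ 1 / ζ := by
      rw [le_div_iff₀ hζ]
      have h3' : Real.exp (2 * a) * Real.exp (-(2 * a)) = 1 := by rw [← Real.exp_add]; simp
      nlinarith
    have hlog4 : Real.log (4 * Real.exp (2 * a)) = 2 * Real.log 2 + 2 * a := by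
      rw [Real.log_mul (by norm_num) (Real.exp_pos _).ne', Real.log_exp,
        show (4 : ℝ) = 2 ^ 2 by norm_num, Real.log_pow]
      push_cast; ring
    have := Real.log_le_log (by positivity) hq
    linarith
  have h7 := Real.log_two_gt_d9
  have hN0 : 0 ≤ ∫ x : ℝ, ‖g x‖ ^ 2 := integral_nonneg fun x ↦ by positivity
  rw [hdiff] at h
  have hX : a ≤ 2 * ((∫ t in Ioi ζ, weilArchDensity t) -
        ∫ t in Icc (2 * a - 2 * ζ) (2 * a), weilArchDensity t) -
      (2 * (∫ t in Ioi (0 : ℝ), (Real.exp (t / 2) - 1) / (2 * Real.sinh t)) +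
        (Real.log (4 * π) + Real.eulerMascheroniConstant)) -
      2 * ∑ n ∈ (weilPrimeIndex a).filter (fun n : ℕ ↦ |Real.log (n : ℝ) - (2 * a - ζ)| ≤ ζ),
        (Λ n : ℝ) / Real.sqrt n := by
    linarith
  calc a * ∫ x : ℝ, ‖g x‖ ^ 2 = (∫ x : ℝ, ‖g x‖ ^ 2) * a := mul_comm _ _
    _ ≤ _ := mul_le_mul_of_nonneg_left hX hN0
    _ ≤ weilMarkovQuadratic g := h

end EdgeLayers

end Summit.RiemannHypothesis.RiemannHypothesis.Theorems.PolarPerronFrobenius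

end
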